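import Summits.AtomisticToContinuum.Crystallization.Theorems.FrustratedLawDichotomyNoTwistOfPairBound

/-!
# FrustratedLawDichotomy · crux `AperiodicFrustratedLawGap` (stmt-AtomisticToContinuum-27623) — monotonicity of the scalar link bounds
# (decomp-a2c, prover hand 2, gen 10)

The four P-side certificate statements `LinkPairBound θ D₀ ρ Pat` (p823632; `ρ = √2`: `LinkDiagonalBound`, p823469) are ANTITONE in the
tolerance `θ` (a smaller tolerance shrinks the admissible set) and in the bound `D₀`: a value certified once at `θ = 1/100` serves every
`θ' ≤ 1/100` (the dial, the `1/200` literal).  `[folklore]`; def-free; no `sorry`.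

* `bondLike_mono_tol` : `θ' ≤ θ → BondLike θ' K X Y → BondLike θ K X Y`;
* `linkPairBound_antitone_tol` : `θ' ≤ θ → LinkPairBound θ D₀ ρ Pat → LinkPairBound θ' D₀ ρ Pat`;
* `linkPairBound_mono_bound` : `D₁ ≤ D₀ → LinkPairBound θ D₀ ρ Pat → LinkPairBound θ D₁ ρ Pat`;
* the `LinkDiagonalBound` versions.
-/

noncomputable section

namespace Summit.AtomisticToContinuum.Crystallization.Theorems.FrustratedLawDichotomyScalarBoundsMono

open Literature.Geometry.DiscreteGeometry
open Summit.AtomisticToContinuum.Crystallization.Theorems.FrustratedLawDichotomyTwoShellRigidityCut (E3)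
open Summit.AtomisticToContinuum.Crystallization.Theorems.FrustratedLawDichotomyNoTwistCert (BondLike)
open Summit.AtomisticToContinuum.Crystallization.Theorems.FrustratedLawDichotomyCapMatchOfDiagonal (LinkDiagonalBound)
open Summit.AtomisticToContinuum.Crystallization.Theorems.FrustratedLawDichotomyNoTwistOfPairBound
  (LinkPairBound linkDiagonalBound_iff_pairBound)

/-- A coupled window at a smaller tolerance is a coupled window at a larger one. [folklore] -/
theorem bondLike_mono_tol {θ θ' : ℝ} {K : Set E3} {X Y : E3} (hθ : θ' ≤ θ) (h : BondLike θ' K X Y) : BondLike θ K X Y := by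
  refine ⟨fun Z hZ hne => (h.1 Z hZ hne).trans ?_, fun Z hZ hne => (h.2 Z hZ hne).trans ?_⟩
  · exact mul_le_mul_of_nonneg_right (by linarith) (norm_nonneg _)
  · exact mul_le_mul_of_nonneg_right (by linarith) (norm_nonneg _)

/-- **`LinkPairBound` is antitone in the tolerance.** [folklore] -/
theorem linkPairBound_antitone_tol {θ θ' D₀ ρ : ℝ} {Pat : Finset E3} (hθ : θ' ≤ θ) (h : LinkPairBound θ D₀ ρ Pat) :
    LinkPairBound θ' D₀ ρ Pat := by
  intro p hrad hinj hB0 hBc hS a c hac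
  exact h p (fun u => ⟨(hrad u).1, (hrad u).2.trans (by linarith)⟩) hinj (fun u => bondLike_mono_tol hθ (hB0 u))
    (fun u v huv => bondLike_mono_tol hθ (hBc u v huv)) hS a c hac

/-- **`LinkPairBound` is monotone in the bound**: a larger certified bound gives every smaller one. [folklore] -/
theorem linkPairBound_mono_bound {θ D₀ D₁ ρ : ℝ} {Pat : Finset E3} (hD : D₁ ≤ D₀) (h : LinkPairBound θ D₀ ρ Pat) :
    LinkPairBound θ D₁ ρ Pat :=
  fun p hrad hinj hB0 hBc hS a c hac => hD.trans (h p hrad hinj hB0 hBc hS a c hac)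

/-- **`LinkDiagonalBound` is antitone in the tolerance.** [folklore] -/
theorem linkDiagonalBound_antitone_tol {θ θ' d₀ : ℝ} {Pat : Finset E3} (hθ : θ' ≤ θ) (h : LinkDiagonalBound θ d₀ Pat) :
    LinkDiagonalBound θ' d₀ Pat :=
  linkDiagonalBound_iff_pairBound.2 (linkPairBound_antitone_tol hθ (linkDiagonalBound_iff_pairBound.1 h))

/-- **`LinkDiagonalBound` is monotone in the bound.** [folklore] -/
theorem linkDiagonalBound_mono_bound {θ d₀ d₁ : ℝ} {Pat : Finset E3} (hd : d₁ ≤ d₀) (h : LinkDiagonalBound θ d₀ Pat) :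
    LinkDiagonalBound θ d₁ Pat :=
  linkDiagonalBound_iff_pairBound.2 (linkPairBound_mono_bound hd (linkDiagonalBound_iff_pairBound.1 h))

/-- **The `θ = 1/100` scalar bounds serve the `1/200` literal**: `LinkPairBound (1/100) (17/10) √3 → LinkPairBound (1/200) (5/3) √3` and
`LinkDiagonalBound (1/100) (6/5) → LinkDiagonalBound (1/200) (23/20)`. [folklore] -/
theorem scalarBounds_twoHundredth_of_hundredth {Pat : Finset E3} :
    (LinkPairBound (1 / 100) (17 / 10) (Real.sqrt 3) Pat → LinkPairBound (1 / 200) (5 / 3) (Real.sqrt 3) Pat) ∧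
      (LinkDiagonalBound (1 / 100) (6 / 5) Pat → LinkDiagonalBound (1 / 200) (23 / 20) Pat) :=
  ⟨fun h => linkPairBound_mono_bound (by norm_num) (linkPairBound_antitone_tol (by norm_num) h),
   fun h => linkDiagonalBound_mono_bound (by norm_num) (linkDiagonalBound_antitone_tol (by norm_num) h)⟩

end Summit.AtomisticToContinuum.Crystallization.Theorems.FrustratedLawDichotomyScalarBoundsMono

end
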